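import Literature.Computability.QuantumComplexity.ZXCalculusSwitchHadamard
import Literature.Computability.QuantumComplexity.ZXCalculusSwitchSame
import HarnessLib

/-!
# ZX-calculus: discarding around the switch

From `controlsep-surrounded-by-h`: a green state on the transistor's target disconnects it (`red-state-on-controlsep`, second
part), whence, by bending, discarding the switch's output discards both inputs (`sw ⨾ Z^{(1,0)} = Z^{(1,0)} ⊗ Z^{(1,0)}`), and the
anti-controlled pair of switches is the clean zero map.
[cite: JeandelPerdrixVilmart2019, Appendix B, Lemmas `red-state-on-controlsep`, `two-consecutive-controlsep-anticontrol`]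
-/

namespace Literature.Computability.QuantumComplexity

open ZXDiagram

namespace ZXClass

/-- **JPV'19 `red-state-on-controlsep`, second part**: a green state on the target of the transistor disconnects it: `(𝕀 ⊗ Z^{(0,1)}) ⨾ τ = Z^{(1,0)} ⨾ Z^{(0,1)}` (via `controlsep-surrounded-by-h` and the red-state law of the switch). [cite: JeandelPerdrixVilmart2019, Appendix B, Lemma `red-state-on-controlsep` and its proof] -/
theorem par_Z_state_seq_transistor : mk (wires 1) ⊠ mk (Z 0 1 0) ⨟ mk (dumbbell 0 0) ⊠ (mk (X 1 2 0) ⊠ mk (wires 1) ⨟ mk triangle ⊠ (mk (Z 2 1 0) ⨟ (mk triangle).transpose) ⨟ mk (Z 2 1 0)) = mk (Z 1 0 0) ⨟ mk (Z 0 1 0) := by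
  have s0 : mk (wires 1) ⊠ mk (Z 0 1 0) ⨟ mk (dumbbell 0 0) ⊠ (mk (X 1 2 0) ⊠ mk (wires 1) ⨟ mk triangle ⊠ (mk (Z 2 1 0) ⨟ (mk triangle).transpose) ⨟ mk (Z 2 1 0)) = _ := cgr (_ : ZXClass 1 2) (show mk (dumbbell 0 0) ⊠ (mk (X 1 2 0) ⊠ mk (wires 1) ⨟ mk triangle ⊠ (mk (Z 2 1 0) ⨟ (mk triangle).transpose) ⨟ mk (Z 2 1 0)) = mk (wires 1) ⊠ mk hBox ⨟ mk swap ⨟ mk switch ⨟ mk hBox from transistor_eq_hBox_switch_hBox)  -- surr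
  have s1 := s0.trans ((show mk (wires 1) ⊠ mk (Z 0 1 0) ⨟ (mk (wires 1) ⊠ mk hBox ⨟ mk swap ⨟ mk switch ⨟ mk hBox) = mk (wires 1) ⊠ mk (Z 0 1 0) ⨟ mk (wires 1) ⊠ mk hBox ⨟ mk swap ⨟ mk switch ⨟ mk hBox from by simp only [seq_assoc]))  -- assoc
  have s2 := s1.trans (cgl (cgl (cgl (show mk (wires 1) ⊠ mk (Z 0 1 0) ⨟ mk (wires 1) ⊠ mk hBox = mk (wires 1) ⊠ (mk (Z 0 1 0) ⨟ mk hBox) from (wires_par_seq 1 _ _).symm) (_ : ZXClass 2 2)) (_ : ZXClass 2 1)) (_ : ZXClass 1 1))  -- wires_par_seq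
  have s3 := s2.trans (cgl (cgl (cgl (cpr (_ : ZXClass 1 1) (show mk (Z 0 1 0) ⨟ mk hBox = mk (X 0 1 0) from (show mk (Z 0 1 0) ⨟ mk hBox = mk (X 0 1 0) from by simpa [hTensor_zero, hTensor_one] using rule_H' 0 1 0))) (_ : ZXClass 2 2)) (_ : ZXClass 2 1)) (_ : ZXClass 1 1))  -- Z01_H
  have s4 := s3.trans (cgl (cgl (show mk (wires 1) ⊠ mk (X 0 1 0) ⨟ mk swap = mk (X 0 1 0) ⊠ mk (wires 1) from (par_state_seq_swap (mk (wires 1)) (mk (X 0 1 0)))) (_ : ZXClass 2 1)) (_ : ZXClass 1 1))  -- par_state_seq_swap_X01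
  have s5 := s4.trans (cgl (cgl (show mk (X 0 1 0) ⊠ mk (wires 1) = mk invSqrtTwo ⊠ (mk (dumbbell 0 0) ⊠ (mk (X 0 1 0) ⊠ mk (wires 1))) from (invSqrtTwo_par_sqrt_two_par_one_two _).symm) (_ : ZXClass 2 1)) (_ : ZXClass 1 1))  -- 1 = invs2·√2
  have s6 := s5.trans (cgl (cgl (show mk invSqrtTwo ⊠ (mk (dumbbell 0 0) ⊠ (mk (X 0 1 0) ⊠ mk (wires 1))) = mk (dumbbell 0 0) ⊠ (mk invSqrtTwo ⊠ (mk (X 0 1 0) ⊠ mk (wires 1))) from scalar_par_scalar_par _ _ _) (_ : ZXClass 2 1)) (_ : ZXClass 1 1))  -- scalars commute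
  have s7 := s6.trans (cgl (cgl (cpr (_ : ZXClass 0 0) (show mk invSqrtTwo ⊠ (mk (X 0 1 0) ⊠ mk (wires 1)) = mk invSqrtTwo ⊠ mk (X 0 1 0) ⊠ mk (wires 1) from (par_assoc' _ _ _).trans (cast_id _ _ _))) (_ : ZXClass 2 1)) (_ : ZXClass 1 1))  -- scalar
  have s8 := s7.trans (cgl (show mk (dumbbell 0 0) ⊠ (mk invSqrtTwo ⊠ mk (X 0 1 0) ⊠ mk (wires 1)) ⨟ mk switch = mk (dumbbell 0 0) ⊠ (mk invSqrtTwo ⊠ mk (X 0 1 0) ⊠ mk (wires 1) ⨟ mk switch) from by rw [scalar_par_seq_left (mk (dumbbell 0 0)) (mk invSqrtTwo ⊠ mk (X 0 1 0) ⊠ mk (wires 1)) (mk switch), empty_par, cast_id]) (_ : ZXClass 1 1))  -- scalar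
  have s9 := s8.trans ((show mk (dumbbell 0 0) ⊠ (mk invSqrtTwo ⊠ mk (X 0 1 0) ⊠ mk (wires 1) ⨟ mk switch) ⨟ mk hBox = mk (dumbbell 0 0) ⊠ (mk invSqrtTwo ⊠ mk (X 0 1 0) ⊠ mk (wires 1) ⨟ mk switch ⨟ mk hBox) from by rw [scalar_par_seq_left (mk (dumbbell 0 0)) (mk invSqrtTwo ⊠ mk (X 0 1 0) ⊠ mk (wires 1) ⨟ mk switch) (mk hBox), empty_par, cast_id]))  -- scalar
  have s10 := s9.trans (cpr (_ : ZXClass 0 0) (cgl (show mk invSqrtTwo ⊠ mk (X 0 1 0) ⊠ mk (wires 1) ⨟ mk switch = mk invSqrtTwo ⊠ mk (X 0 1 0) ⊠ mk (Z 1 0 0) from ket0_par_seq_switch) (_ : ZXClass 1 1)))  -- ket0_par_seq_switch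
  have s11 := s10.trans (cpr (_ : ZXClass 0 0) (cgl (show mk invSqrtTwo ⊠ mk (X 0 1 0) ⊠ mk (Z 1 0 0) = mk invSqrtTwo ⊠ (mk (X 0 1 0) ⊠ mk (Z 1 0 0)) from (par_assoc _ _ _).trans (cast_id _ _ _)) (_ : ZXClass 1 1)))  -- scalar
  have s12 := s11.trans (cpr (_ : ZXClass 0 0) (show mk invSqrtTwo ⊠ (mk (X 0 1 0) ⊠ mk (Z 1 0 0)) ⨟ mk hBox = mk invSqrtTwo ⊠ (mk (X 0 1 0) ⊠ mk (Z 1 0 0) ⨟ mk hBox) from by rw [scalar_par_seq_left (mk invSqrtTwo) (mk (X 0 1 0) ⊠ mk (Z 1 0 0)) (mk hBox), empty_par, cast_id]))  -- scalar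
  have s13 := s12.trans ((show mk (dumbbell 0 0) ⊠ (mk invSqrtTwo ⊠ (mk (X 0 1 0) ⊠ mk (Z 1 0 0) ⨟ mk hBox)) = mk (X 0 1 0) ⊠ mk (Z 1 0 0) ⨟ mk hBox from sqrt_two_par_invSqrtTwo_par_one _))  -- √2·invs2 = 1
  have s14 := s13.trans (cgl (show mk (X 0 1 0) ⊠ mk (Z 1 0 0) = mk (Z 1 0 0) ⨟ mk (X 0 1 0) from by rw [par_eq_seq_right (mk (X 0 1 0)) (mk (Z 1 0 0)), empty_par, cast_id, par_empty]) (_ : ZXClass 1 1))  -- state⊗effect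
  have s15 := s14.trans ((show mk (Z 1 0 0) ⨟ mk (X 0 1 0) ⨟ mk hBox = mk (Z 1 0 0) ⨟ (mk (X 0 1 0) ⨟ mk hBox) from by simp only [seq_assoc]))  -- assoc
  have s16 := s15.trans (cgr (_ : ZXClass 1 0) (show mk (X 0 1 0) ⨟ mk hBox = mk (Z 0 1 0) from (show mk (X 0 1 0) ⨟ mk hBox = mk (Z 0 1 0) from by simpa [hTensor_zero, hTensor_one] using rule_H 0 1 0)))  -- X01_H
  exact s16

/-- **Discarding the output of the switch discards its inputs**: `sw ⨾ Z^{(1,0)} = Z^{(1,0)} ⊗ Z^{(1,0)}` (the switch law obtained by bending `red-state-on-controlsep`, second part). [cite: JeandelPerdrixVilmart2019, Appendix B, Lemma `red-state-on-controlsep`; JeandelPerdrixVilmart2018, §2.2] -/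
theorem switch_seq_Z_effect : mk switch ⨟ mk (Z 1 0 0) = mk (Z 1 0 0) ⊠ mk (Z 1 0 0) := by
  have s0 : mk switch ⨟ mk (Z 1 0 0) = _ := cgl (show mk switch = mk (wires 2) ⊠ mk cup ⨟ mk (wires 1) ⊠ (mk (dumbbell 0 0) ⊠ (mk (X 1 2 0) ⊠ mk (wires 1) ⨟ mk triangle ⊠ (mk (Z 2 1 0) ⨟ (mk triangle).transpose) ⨟ mk (Z 2 1 0))) ⊠ mk (wires 1) ⨟ mk cap ⊠ mk (wires 1) from (flat_core_eq_switch).symm) (_ : ZXClass 1 0)  -- flat_core_eq_switch⁻¹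
  have s1 := s0.trans ((show mk (wires 2) ⊠ mk cup ⨟ mk (wires 1) ⊠ (mk (dumbbell 0 0) ⊠ (mk (X 1 2 0) ⊠ mk (wires 1) ⨟ mk triangle ⊠ (mk (Z 2 1 0) ⨟ (mk triangle).transpose) ⨟ mk (Z 2 1 0))) ⊠ mk (wires 1) ⨟ mk cap ⊠ mk (wires 1) ⨟ mk (Z 1 0 0) = mk (wires 2) ⊠ mk cup ⨟ mk (wires 1) ⊠ (mk (dumbbell 0 0) ⊠ (mk (X 1 2 0) ⊠ mk (wires 1) ⨟ mk triangle ⊠ (mk (Z 2 1 0) ⨟ (mk triangle).transpose) ⨟ mk (Z 2 1 0))) ⊠ mk (wires 1) ⨟ (mk cap ⊠ mk (wires 1) ⨟ mk (Z 1 0 0)) from by simp only [seq_assoc]))  -- assoc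
  have s2 := s1.trans (cgr (_ : ZXClass 2 3) (show mk cap ⊠ mk (wires 1) ⨟ mk (Z 1 0 0) = mk cap ⊠ mk (Z 1 0 0) from (by rw [par_eq_seq_left (mk cap) (mk (Z 1 0 0)), empty_par, cast_id] : mk cap ⊠ mk (Z 1 0 0) = _).symm))  -- effect
  have s3 := s2.trans (cgr (_ : ZXClass 2 3) (show mk cap ⊠ mk (Z 1 0 0) = mk (wires 2) ⊠ mk (Z 1 0 0) ⨟ mk cap ⊠ mk (wires 0) from par_eq_seq_right _ _))  -- par_eq_seq
  have s4 := s3.trans (cgr (_ : ZXClass 2 3) (cgr (_ : ZXClass 3 2) (show mk cap ⊠ mk (wires 0) = mk cap from par_empty _)))  -- par_empty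
  have s5 := s4.trans ((show mk (wires 2) ⊠ mk cup ⨟ mk (wires 1) ⊠ (mk (dumbbell 0 0) ⊠ (mk (X 1 2 0) ⊠ mk (wires 1) ⨟ mk triangle ⊠ (mk (Z 2 1 0) ⨟ (mk triangle).transpose) ⨟ mk (Z 2 1 0))) ⊠ mk (wires 1) ⨟ (mk (wires 2) ⊠ mk (Z 1 0 0) ⨟ mk cap) = mk (wires 2) ⊠ mk cup ⨟ mk (wires 1) ⊠ (mk (dumbbell 0 0) ⊠ (mk (X 1 2 0) ⊠ mk (wires 1) ⨟ mk triangle ⊠ (mk (Z 2 1 0) ⨟ (mk triangle).transpose) ⨟ mk (Z 2 1 0))) ⊠ mk (wires 1) ⨟ mk (wires 2) ⊠ mk (Z 1 0 0) ⨟ mk cap from by simp only [seq_assoc]))  -- assoc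
  have s6 := s5.trans (cgl (show mk (wires 2) ⊠ mk cup ⨟ mk (wires 1) ⊠ (mk (dumbbell 0 0) ⊠ (mk (X 1 2 0) ⊠ mk (wires 1) ⨟ mk triangle ⊠ (mk (Z 2 1 0) ⨟ (mk triangle).transpose) ⨟ mk (Z 2 1 0))) ⊠ mk (wires 1) ⨟ mk (wires 2) ⊠ mk (Z 1 0 0) = mk (wires 2) ⊠ mk cup ⨟ (mk (wires 1) ⊠ (mk (dumbbell 0 0) ⊠ (mk (X 1 2 0) ⊠ mk (wires 1) ⨟ mk triangle ⊠ (mk (Z 2 1 0) ⨟ (mk triangle).transpose) ⨟ mk (Z 2 1 0))) ⊠ mk (wires 1) ⨟ mk (wires 2) ⊠ mk (Z 1 0 0)) from by simp only [seq_assoc]) (_ : ZXClass 2 0))  -- assoc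
  have s7 := s6.trans (cgl (cgr (_ : ZXClass 2 4) (show mk (wires 1) ⊠ (mk (dumbbell 0 0) ⊠ (mk (X 1 2 0) ⊠ mk (wires 1) ⨟ mk triangle ⊠ (mk (Z 2 1 0) ⨟ (mk triangle).transpose) ⨟ mk (Z 2 1 0))) ⊠ mk (wires 1) ⨟ mk (wires 2) ⊠ mk (Z 1 0 0) = (mk (wires 1) ⊠ (mk (dumbbell 0 0) ⊠ (mk (X 1 2 0) ⊠ mk (wires 1) ⨟ mk triangle ⊠ (mk (Z 2 1 0) ⨟ (mk triangle).transpose) ⨟ mk (Z 2 1 0))) ⨟ mk (wires 2)) ⊠ (mk (wires 1) ⨟ mk (Z 1 0 0)) from interchange _ _ _ _)) (_ : ZXClass 2 0))  -- interchange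
  have s8 := s7.trans (cgl (cgr (_ : ZXClass 2 4) (cpl (show mk (wires 1) ⊠ (mk (dumbbell 0 0) ⊠ (mk (X 1 2 0) ⊠ mk (wires 1) ⨟ mk triangle ⊠ (mk (Z 2 1 0) ⨟ (mk triangle).transpose) ⨟ mk (Z 2 1 0))) ⨟ mk (wires 2) = mk (wires 1) ⊠ (mk (dumbbell 0 0) ⊠ (mk (X 1 2 0) ⊠ mk (wires 1) ⨟ mk triangle ⊠ (mk (Z 2 1 0) ⨟ (mk triangle).transpose) ⨟ mk (Z 2 1 0))) from seq_id _) (_ : ZXClass 1 0))) (_ : ZXClass 2 0))  -- id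
  have s9 := s8.trans (cgl (cgr (_ : ZXClass 2 4) (cpr (_ : ZXClass 3 2) (show mk (wires 1) ⨟ mk (Z 1 0 0) = mk (Z 1 0 0) from id_seq _))) (_ : ZXClass 2 0))  -- id
  have s10 := s9.trans (cgl (cgr (_ : ZXClass 2 4) (show mk (wires 1) ⊠ (mk (dumbbell 0 0) ⊠ (mk (X 1 2 0) ⊠ mk (wires 1) ⨟ mk triangle ⊠ (mk (Z 2 1 0) ⨟ (mk triangle).transpose) ⨟ mk (Z 2 1 0))) ⊠ mk (Z 1 0 0) = mk (wires 3) ⊠ mk (Z 1 0 0) ⨟ mk (wires 1) ⊠ (mk (dumbbell 0 0) ⊠ (mk (X 1 2 0) ⊠ mk (wires 1) ⨟ mk triangle ⊠ (mk (Z 2 1 0) ⨟ (mk triangle).transpose) ⨟ mk (Z 2 1 0))) ⊠ mk (wires 0) from par_eq_seq_right _ _)) (_ : ZXClass 2 0))  -- par_eq_seq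
  have s11 := s10.trans (cgl (cgr (_ : ZXClass 2 4) (cgr (_ : ZXClass 4 3) (show mk (wires 1) ⊠ (mk (dumbbell 0 0) ⊠ (mk (X 1 2 0) ⊠ mk (wires 1) ⨟ mk triangle ⊠ (mk (Z 2 1 0) ⨟ (mk triangle).transpose) ⨟ mk (Z 2 1 0))) ⊠ mk (wires 0) = mk (wires 1) ⊠ (mk (dumbbell 0 0) ⊠ (mk (X 1 2 0) ⊠ mk (wires 1) ⨟ mk triangle ⊠ (mk (Z 2 1 0) ⨟ (mk triangle).transpose) ⨟ mk (Z 2 1 0))) from par_empty _))) (_ : ZXClass 2 0))  -- par_empty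
  have s12 := s11.trans ((show mk (wires 2) ⊠ mk cup ⨟ (mk (wires 3) ⊠ mk (Z 1 0 0) ⨟ mk (wires 1) ⊠ (mk (dumbbell 0 0) ⊠ (mk (X 1 2 0) ⊠ mk (wires 1) ⨟ mk triangle ⊠ (mk (Z 2 1 0) ⨟ (mk triangle).transpose) ⨟ mk (Z 2 1 0)))) ⨟ mk cap = mk (wires 2) ⊠ mk cup ⨟ mk (wires 3) ⊠ mk (Z 1 0 0) ⨟ mk (wires 1) ⊠ (mk (dumbbell 0 0) ⊠ (mk (X 1 2 0) ⊠ mk (wires 1) ⨟ mk triangle ⊠ (mk (Z 2 1 0) ⨟ (mk triangle).transpose) ⨟ mk (Z 2 1 0))) ⨟ mk cap from by simp only [seq_assoc]))  -- assoc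
  have s13 := s12.trans (cgl (cgl (cgr (_ : ZXClass 2 4) (cpl (show mk (wires 3) = mk (wires 2) ⊠ mk (wires 1) from (wires_par_wires 2 1).symm) (_ : ZXClass 1 0))) (_ : ZXClass 3 2)) (_ : ZXClass 2 0))  -- wires
  have s14 := s13.trans (cgl (cgl (cgr (_ : ZXClass 2 4) (show mk (wires 2) ⊠ mk (wires 1) ⊠ mk (Z 1 0 0) = mk (wires 2) ⊠ (mk (wires 1) ⊠ mk (Z 1 0 0)) from (par_assoc _ _ _).trans (cast_id _ _ _))) (_ : ZXClass 3 2)) (_ : ZXClass 2 0))  -- par_assoc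
  have s15 := s14.trans (cgl (cgl (show mk (wires 2) ⊠ mk cup ⨟ mk (wires 2) ⊠ (mk (wires 1) ⊠ mk (Z 1 0 0)) = mk (wires 2) ⊠ (mk cup ⨟ mk (wires 1) ⊠ mk (Z 1 0 0)) from (wires_par_seq 2 _ _).symm) (_ : ZXClass 3 2)) (_ : ZXClass 2 0))  -- wires_par_seq
  have s16 := s15.trans (cgl (cgl (cpr (_ : ZXClass 2 2) (cgl (show mk cup = mk (Z 0 2 0) from (Z_zero_two).symm) (_ : ZXClass 2 1))) (_ : ZXClass 3 2)) (_ : ZXClass 2 0))  -- Z_zero_two⁻¹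
  have s17 := s16.trans (cgl (cgl (cpr (_ : ZXClass 2 2) (show mk (Z 0 2 0) ⨟ mk (wires 1) ⊠ mk (Z 1 0 0) = mk (Z 0 1 0) from (Z_seq_par_Z 0 1 1 0 le_rfl 0 0))) (_ : ZXClass 3 2)) (_ : ZXClass 2 0))  -- Z02_seq_par_Z10
  have s18 := s17.trans (cgl (cgl (cpl (show mk (wires 2) = mk (wires 1) ⊠ mk (wires 1) from (wires_par_wires 1 1).symm) (_ : ZXClass 0 1)) (_ : ZXClass 3 2)) (_ : ZXClass 2 0))  -- wires
  have s19 := s18.trans (cgl (cgl (show mk (wires 1) ⊠ mk (wires 1) ⊠ mk (Z 0 1 0) = mk (wires 1) ⊠ (mk (wires 1) ⊠ mk (Z 0 1 0)) from (par_assoc _ _ _).trans (cast_id _ _ _)) (_ : ZXClass 3 2)) (_ : ZXClass 2 0))  -- par_assoc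
  have s20 := s19.trans (cgl (show mk (wires 1) ⊠ (mk (wires 1) ⊠ mk (Z 0 1 0)) ⨟ mk (wires 1) ⊠ (mk (dumbbell 0 0) ⊠ (mk (X 1 2 0) ⊠ mk (wires 1) ⨟ mk triangle ⊠ (mk (Z 2 1 0) ⨟ (mk triangle).transpose) ⨟ mk (Z 2 1 0))) = mk (wires 1) ⊠ (mk (wires 1) ⊠ mk (Z 0 1 0) ⨟ (mk (dumbbell 0 0) ⊠ (mk (X 1 2 0) ⊠ mk (wires 1) ⨟ mk triangle ⊠ (mk (Z 2 1 0) ⨟ (mk triangle).transpose) ⨟ mk (Z 2 1 0)))) from (wires_par_seq 1 _ _).symm) (_ : ZXClass 2 0))  -- wires_par_seq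
  have s21 := s20.trans (cgl (cpr (_ : ZXClass 1 1) (show mk (wires 1) ⊠ mk (Z 0 1 0) ⨟ (mk (dumbbell 0 0) ⊠ (mk (X 1 2 0) ⊠ mk (wires 1) ⨟ mk triangle ⊠ (mk (Z 2 1 0) ⨟ (mk triangle).transpose) ⨟ mk (Z 2 1 0))) = mk (Z 1 0 0) ⨟ mk (Z 0 1 0) from par_Z_state_seq_transistor)) (_ : ZXClass 2 0))  -- part2A
  have s22 := s21.trans (cgl (show mk (wires 1) ⊠ (mk (Z 1 0 0) ⨟ mk (Z 0 1 0)) = mk (wires 1) ⊠ mk (Z 1 0 0) ⨟ mk (wires 1) ⊠ mk (Z 0 1 0) from by simp only [wires_par_seq]) (_ : ZXClass 2 0))  -- wires_par_seq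
  have s23 := s22.trans ((show mk (wires 1) ⊠ mk (Z 1 0 0) ⨟ mk (wires 1) ⊠ mk (Z 0 1 0) ⨟ mk cap = mk (wires 1) ⊠ mk (Z 1 0 0) ⨟ (mk (wires 1) ⊠ mk (Z 0 1 0) ⨟ mk cap) from by simp only [seq_assoc]))  -- assoc
  have s24 := s23.trans (cgr (_ : ZXClass 2 1) (cgr (_ : ZXClass 1 2) (show mk cap = mk (Z 2 0 0) from (Z_two_zero).symm)))  -- Z_two_zero⁻¹
  have s25 := s24.trans (cgr (_ : ZXClass 2 1) (show mk (wires 1) ⊠ mk (Z 0 1 0) ⨟ mk (Z 2 0 0) = mk (Z 1 0 0) from (par_Z_seq_Z 1 0 1 0 le_rfl 0 0)))  -- par_Z01_seq_Z20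
  have s26 := s25.trans (cgr (_ : ZXClass 2 1) (show mk (Z 1 0 0) = mk (Z 1 0 0) ⊠ mk (wires 0) from (par_empty _).symm))  -- par_empty
  have s27 := s26.trans ((show mk (wires 1) ⊠ mk (Z 1 0 0) ⨟ mk (Z 1 0 0) ⊠ mk (wires 0) = (mk (wires 1) ⨟ mk (Z 1 0 0)) ⊠ (mk (Z 1 0 0) ⨟ mk (wires 0)) from interchange _ _ _ _))  -- interchange
  have s28 := s27.trans (cpl (show mk (wires 1) ⨟ mk (Z 1 0 0) = mk (Z 1 0 0) from id_seq _) (_ : ZXClass 1 0))  -- id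
  have s29 := s28.trans (cpr (_ : ZXClass 1 0) (show mk (Z 1 0 0) ⨟ mk (wires 0) = mk (Z 1 0 0) from seq_id _))  -- id
  exact s29

/-- **JPV'19 `two-consecutive-controlsep-anticontrol`, switch orientation**: `(𝕀 ⊗ (Z^{(1,2)} ⨾ (𝕀 ⊗ X(π)))) ⨾ (sw ⊗ 𝕀) ⨾ sw = (Z^{(1,0)} ⊗ Z^{(1,0)}) ⨾ (1/√2 ⊗ X^{(0,1)})` — both inputs are discarded and `|0⟩` is emitted (`(t ∧ ¬x) ∧ x = 0`). [cite: JeandelPerdrixVilmart2019, Appendix B, Lemma `two-consecutive-controlsep-anticontrol`] -/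
theorem switch_anticontrol : mk (wires 1) ⊠ (mk (Z 1 2 0) ⨟ mk (wires 1) ⊠ mk (X 1 1 4)) ⨟ mk switch ⊠ mk (wires 1) ⨟ mk switch = mk (Z 1 0 0) ⊠ mk (Z 1 0 0) ⨟ mk invSqrtTwo ⊠ mk (X 0 1 0) := by
  have s0 : mk (wires 1) ⊠ (mk (Z 1 2 0) ⨟ mk (wires 1) ⊠ mk (X 1 1 4)) ⨟ mk switch ⊠ mk (wires 1) ⨟ mk switch = _ := (show mk (wires 1) ⊠ (mk (Z 1 2 0) ⨟ mk (wires 1) ⊠ mk (X 1 1 4)) ⨟ mk switch ⊠ mk (wires 1) ⨟ mk switch = mk switch ⨟ mk (Z 1 0 0) ⨟ mk invSqrtTwo ⊠ mk (X 0 1 0) from zsplit_pi_seq_switch_par_seq_switch)  -- L5raw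
  have s1 := s0.trans (cgl (show mk switch ⨟ mk (Z 1 0 0) = mk (Z 1 0 0) ⊠ mk (Z 1 0 0) from switch_seq_Z_effect) (_ : ZXClass 0 1))  -- L7
  exact s1


end ZXClass

end Literature.Computability.QuantumComplexity
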